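import Summits.BirchSwinnertonDyer.Rank1Residual.X4.PathFunctionExactOfCycles
import Literature.NumberTheory.EllipticCurves.ModularCurveIharaLemma
import HarnessLib

/-!
# `1 − w[ℓ]` IS INJECTIVE on the path functions of block-supported functionals — FROM IHARA'S LEMMA BY NAME: if `μ_Λ − w·μ_Λ∘[ℓ] = 0` for the path function of a functional `Λ` on `H₁(X₀(M), ℤ)` supported at a non-Eisenstein maximal ideal `𝔫`, then `Λ = 0` on `H₁(X₀(M), ℤ)` and `μ_Λ = 0` (cell `b2b-bsdres`, seat additive-p4 gen 32, line V54 — the hypothesis `hinj₀` of `X4/KuriharaAdditiveCertificateOfExactness.lean` on the theory side)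

HONEST FRAMING (verbatim, cell `b2b-bsdres`): the goal of the cell is to DELETE the COMBINATION-SHAPED
residual classes for ALL analytic-rank `≤ 1` curves over `ℚ` — "full BSD formula for every rank `≤ 1`
curve in class `C`" assembled STRICTLY from published theorems — so that the rank-`≤ 1` remainder
becomes exactly the CONSTRUCTION-SHAPED classes, which are TYPED (missing-input Props), NOT attempted;
this is not "finishing BSD". This file: TOOL theorems (modular symbols / period homology), 0 defs, 0
facts (Ihara's lemma enters BY NAME as the hypothesis `hI : ribet1984_iharaLemma`), nothing booked; X4
CONSTRUCTION-SHAPED.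

## What is proved

K91 (`plusSymbolLevelLowersAdditivelyModAt_of_exact`) asks, besides exactness, that `g ↦ g − g∘[ℓ₂]`
be injective on the set `P₀` of level-`N/ℓ₁ℓ₂` functions (`hinj₀`); K92 realises `P₀` as the path
functions `μ_Λ(r) = c·Λ((T_{q₀} − q₀ − 1){∞, r})` of a family of functionals `Λ` on `H₁(X₀(M), ℤ)`
(`M = N/ℓ₁ℓ₂`). THIS FILE proves `hinj₀` for functionals SUPPORTED at a maximal ideal `𝔫` of
`𝕋̃ = ℤ[T_r : r ∤ Mℓ]` (`Λ ∘ t = 0 on H₁ ⟹ Λ = 0 on H₁` for every `t ∉ 𝔫`) from Ihara's lemma: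

* (tools: the tree's `dualMap_degeneracyMap0_T_smul` — `α_*(T_q • z) = T_q • α_* z` — and
  `X4/PathFunctionExactOfCycles.exists_eq_zero_or_eq_symbol_of_mem_periodHomology` — every cycle is ONE
  period functional.)
* `pathFun_sub_smul_comp_eq` — `μ_Λ(r) − w·μ_Λ(ℓ r) = c·Λ''((T_{q₀} − q₀ − 1){∞, r}_{Mℓ})` with the
  level-`Mℓ` functional `Λ'' = Λ∘α_* − w·Λ∘β_*` (`α_*{∞,r} = {∞,r}`, `β_*{∞,r} = {∞,ℓr}`, `q₀ ≡ 1 (Mℓ)`).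
* **`apply_eq_zero_of_pathFun_sub_smul_comp_eq_zero_of_ribet1984_iharaLemma`** — if
  `μ_Λ − w·μ_Λ∘[ℓ] = 0` (`c` a unit, `T_{q₀} − q₀ − 1 ∉ 𝔫`, `2 ∉ 𝔫`, `𝔫` maximal), then `Λ = 0` on
  `H₁(X₀(M), ℤ)`: `Λ''` kills `(T_{q₀} − q₀ − 1)·H₁(X₀(Mℓ), ℤ)` (every cycle is ONE period functional
  `{∞, γ∞}`); Ihara at `𝔫` lifts `(s x, 0)` to a level-`Mℓ` cycle `z`, so
  `Λ((T_{q₀} − q₀ − 1) s x) = Λ''((T_{q₀} − q₀ − 1) z) = 0`; `(T_{q₀} − q₀ − 1) s ∉ 𝔫`; support.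
* **`pathFun_eq_zero_of_sub_smul_comp_eq_zero_of_ribet1984_iharaLemma`** — hence `μ_Λ = 0`: the
  hypothesis `hinj₀` of K91 / `exists_families_of_exact` for block-supported path-function sets, ANY `w`.

## References

* K. A. Ribet, Proc. ICM 1983 (1984), Thm. 4.1 (Ihara's lemma) — BY NAME. [cite: Ribet1984ICM, Thm. 4.1]
* H. Darmon, F. Diamond, R. Taylor, *Fermat's Last Theorem* (1995), Lemma 4.28, §4.3. [cite: DarmonDiamondTaylor1995, Lemma 4.28 (p. 135)]
* F. Diamond, J. Shurman, *A First Course in Modular Forms* (2005), Prop. 5.6.2. [cite: DiamondShurman2005, Prop. 5.6.2]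
* Ju. I. Manin, Izv. Akad. Nauk SSSR 36 (1972), Thm. 3.3 (20), Thm. 3.5 (22). [cite: Manin1972, Thm. 3.3 (20) and Thm. 3.5 (22)]
-/

noncomputable section

open scoped MatrixGroups ModularForm

open CongruenceSubgroup Finset Matrix

open Literature.NumberTheory.EllipticCurves Literature.NumberTheory.EllipticCurves.ModularForms
  Literature.NumberTheory.EllipticCurves.ModularForms.HidaCohomology

namespace Summit.BirchSwinnertonDyer.Rank1Residual.LevelLowering

section InjectiveOfIhara

variable {k : Type*} [CommRing k] {M : ℕ} [NeZero M] {ℓ : ℕ} [Fact ℓ.Prime]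

/-- Scalars commute with the push-forwards: `α_*((n : ℂ) • z) = (n : ℂ) • α_* z`. [folklore] -/
theorem dualMap_degeneracyMap0_natCast_smul {d : ℕ} [NeZero d] (n : ℕ)
    (z : Module.Dual ℂ (CuspForm (Gamma0 (M * ℓ)) 2)) :
    (degeneracyMap0 M (M * ℓ) d 2).dualMap ((n : ℂ) • z) =
      (n : ℂ) • (degeneracyMap0 M (M * ℓ) d 2).dualMap z :=
  LinearMap.map_smul _ _ _

/-- **`μ_Λ(r) − w·μ_Λ(ℓ r) = c·Λ''((T_{q₀} − q₀ − 1)•{∞, r}_{Mℓ})`** with `Λ'' = Λ∘α_* − w·Λ∘β_*`,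
for the path function `μ_Λ(r) = c·Λ((T_{q₀} − q₀ − 1)•{∞, r}_M)` and `q₀ ≡ 1 (mod Mℓ)`:
`{∞, r}_M = α_*{∞, r}_{Mℓ}`, `{∞, ℓr}_M = β_*{∞, r}_{Mℓ}`, and the closing operator commutes with
`α_*, β_*`. [cite: Manin1972, Thm. 3.3 (20) and Thm. 3.5 (22)] [cite: DiamondShurman2005, Prop. 5.6.2] -/
theorem pathFun_sub_smul_comp_eq (Λ : Module.Dual ℂ (CuspForm (Gamma0 M) 2) → k)
    (σ₀ : ℚ → Module.Dual ℂ (CuspForm (Gamma0 M) 2))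
    (hσ₀ : ∀ (r : ℚ) (f : CuspForm (Gamma0 M) 2), σ₀ r f = modularSymbol f r)
    (σ₁ : ℚ → Module.Dual ℂ (CuspForm (Gamma0 (M * ℓ)) 2))
    (hσ₁ : ∀ (r : ℚ) (f : CuspForm (Gamma0 (M * ℓ)) 2), σ₁ r f = modularSymbol f r)
    {q₀ : ℕ} (hq₀ : q₀.Prime) (hq₀S : ¬ q₀ ∣ M * ℓ) (c w : k) (μ : ℚ → k)
    (hμ : ∀ r, μ r = c * Λ (HeckeRing0.T M 2 q₀ hq₀ • σ₀ r - ((q₀ + 1 : ℕ) : ℂ) • σ₀ r)) (r : ℚ) :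
    μ r - w * μ (ℓ * r) =
      c * (fun z ↦ Λ ((degeneracyMap0 M (M * ℓ) 1 2).dualMap z) -
        w * Λ ((degeneracyMap0 M (M * ℓ) ℓ 2).dualMap z))
        (HeckeRing0.T (M * ℓ) 2 q₀ hq₀ • σ₁ r - ((q₀ + 1 : ℕ) : ℂ) • σ₁ r) := by
  have hℓ : Fact ℓ.Prime := inferInstance
  haveI : NeZero ℓ := ⟨hℓ.out.ne_zero⟩
  have h1 : M * 1 ∣ M * ℓ := by rw [mul_one]; exact dvd_mul_right M ℓ
  have hℓd : M * ℓ ∣ M * ℓ := dvd_refl _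
  -- the symbols: `α_* σ₁ r = σ₀ r`, `β_* σ₁ r = σ₀ (ℓ r)`
  have hα : (degeneracyMap0 M (M * ℓ) 1 2).dualMap (σ₁ r) = σ₀ r := by
    rw [dualMap_degeneracyMap0_symbol h1 σ₁ hσ₁ σ₀ hσ₀ r, Nat.cast_one, one_mul]
  have hβ : (degeneracyMap0 M (M * ℓ) ℓ 2).dualMap (σ₁ r) = σ₀ (ℓ * r) :=
    dualMap_degeneracyMap0_symbol hℓd σ₁ hσ₁ σ₀ hσ₀ r
  -- push the closing operator through `α_*`, `β_*`
  have hA : ∀ (d : ℕ) [NeZero d], M * d ∣ M * ℓ →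
      (degeneracyMap0 M (M * ℓ) d 2).dualMap
          (HeckeRing0.T (M * ℓ) 2 q₀ hq₀ • σ₁ r - ((q₀ + 1 : ℕ) : ℂ) • σ₁ r) =
        HeckeRing0.T M 2 q₀ hq₀ • (degeneracyMap0 M (M * ℓ) d 2).dualMap (σ₁ r) -
          ((q₀ + 1 : ℕ) : ℂ) • (degeneracyMap0 M (M * ℓ) d 2).dualMap (σ₁ r) := by
    intro d _ hd
    rw [map_sub, dualMap_degeneracyMap0_T_smul hd hq₀ hq₀S, dualMap_degeneracyMap0_natCast_smul]
  simp only [hμ]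
  rw [hA 1 h1, hA ℓ hℓd, hα, hβ]
  ring

/-- An additive function on `H₁` vanishes at `0`. [folklore] -/
private theorem apply_zero_of_additiveOn {N : ℕ} [NeZero N] (Φ : Module.Dual ℂ (CuspForm (Gamma0 N) 2) → k)
    (hadd : ∀ x ∈ periodHomology N, ∀ y ∈ periodHomology N, Φ (x + y) = Φ x + Φ y) : Φ 0 = 0 := by
  have h := hadd 0 (periodHomology N).zero_mem 0 (periodHomology N).zero_mem
  rw [add_zero] at h
  linear_combination -h

/-- **`Λ = 0` ON `H₁(X₀(M), ℤ)` FROM `μ_Λ − w·μ_Λ∘[ℓ] = 0` AND IHARA'S LEMMA (BY NAME).** Data: `ℓ ∤ M`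
prime; a maximal ideal `𝔫 ⊂ 𝕋̃ = ℤ[T_r : r ∤ Mℓ]` with `2 ∉ 𝔫`; a closing prime `q₀ ≡ 1 (mod Mℓ)` with
`T_{q₀} − (q₀+1) ∉ 𝔫` (so `𝔫` is non-Eisenstein); `Λ` `k`-valued, additive on `H₁(X₀(M), ℤ)` and
SUPPORTED AT `𝔫` (`Λ(t • ·) = 0` on `H₁` for some `t ∉ 𝔫` forces `Λ = 0` on `H₁`); `μ = μ_Λ` with a unit
constant `c`; and `μ(r) − w·μ(ℓr) = 0` for all `r` (ANY `w`). Then `Λ = 0` on `H₁(X₀(M), ℤ)`. PROOF: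
`Λ'' = Λ∘α_* − wΛ∘β_*` kills `(T_{q₀} − q₀ − 1)•H₁(X₀(Mℓ), ℤ)`; by Ihara at `𝔫` (tree fact
`ribet1984_iharaLemma`: `s ∉ 𝔫` and a lift `z` of `(s x, s·0)`), `Λ((T_{q₀} − q₀ − 1) s x) =
Λ''((T_{q₀} − q₀ − 1) z) = 0` for every cycle `x`; `(T_{q₀} − q₀ − 1) s ∉ 𝔫`; support.
[cite: Ribet1984ICM, Thm. 4.1] [cite: DarmonDiamondTaylor1995, Lemma 4.28 (p. 135)] -/
theorem apply_eq_zero_of_pathFun_sub_smul_comp_eq_zero_of_ribet1984_iharaLemma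
    (hI : ribet1984_iharaLemma) (hℓM : ¬ ℓ ∣ M)
    (𝔫 : Ideal (HeckeRing0.primeTo M 2 (M * ℓ))) (h𝔫 : 𝔫.IsMaximal)
    (h2 : (2 : HeckeRing0.primeTo M 2 (M * ℓ)) ∉ 𝔫)
    (Λ : Module.Dual ℂ (CuspForm (Gamma0 M) 2) → k)
    (hadd : ∀ x ∈ periodHomology M, ∀ y ∈ periodHomology M, Λ (x + y) = Λ x + Λ y)
    (hsupp : ∀ t : HeckeRing0.primeTo M 2 (M * ℓ), t ∉ 𝔫 →
      (∀ x ∈ periodHomology M, Λ ((t : HeckeRing0 M 2) • x) = 0) → ∀ x ∈ periodHomology M, Λ x = 0)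
    (σ₀ : ℚ → Module.Dual ℂ (CuspForm (Gamma0 M) 2))
    (hσ₀ : ∀ (r : ℚ) (f : CuspForm (Gamma0 M) 2), σ₀ r f = modularSymbol f r)
    (σ₁ : ℚ → Module.Dual ℂ (CuspForm (Gamma0 (M * ℓ)) 2))
    (hσ₁ : ∀ (r : ℚ) (f : CuspForm (Gamma0 (M * ℓ)) 2), σ₁ r f = modularSymbol f r)
    {q₀ : ℕ} (hq₀ : q₀.Prime) (hq₀1 : q₀ ≡ 1 [MOD M * ℓ]) (hq₀S : ¬ q₀ ∣ M * ℓ)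
    (hq₀E : HeckeRing0.primeTo.T M 2 (M * ℓ) hq₀ hq₀S -
      ((q₀ : HeckeRing0.primeTo M 2 (M * ℓ)) + 1) ∉ 𝔫)
    {c : k} (hc : IsUnit c) (w : k) (μ : ℚ → k)
    (hμ : ∀ r, μ r = c * Λ (HeckeRing0.T M 2 q₀ hq₀ • σ₀ r - ((q₀ + 1 : ℕ) : ℂ) • σ₀ r))
    (hvan : ∀ r, μ r - w * μ (ℓ * r) = 0) :
    ∀ x ∈ periodHomology M, Λ x = 0 := by
  have hℓ : Fact ℓ.Prime := inferInstance
  haveI : NeZero ℓ := ⟨hℓ.out.ne_zero⟩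
  have h1 : M * 1 ∣ M * ℓ := by rw [mul_one]; exact dvd_mul_right M ℓ
  have hℓd : M * ℓ ∣ M * ℓ := dvd_refl _
  -- the level-`Mℓ` functional `Λ''` and its additivity on `H₁(X₀(Mℓ), ℤ)`
  set Λ'' : Module.Dual ℂ (CuspForm (Gamma0 (M * ℓ)) 2) → k := fun z ↦
    Λ ((degeneracyMap0 M (M * ℓ) 1 2).dualMap z) - w * Λ ((degeneracyMap0 M (M * ℓ) ℓ 2).dualMap z)
    with hΛ''
  have hmemα : ∀ z ∈ periodHomology (M * ℓ), (degeneracyMap0 M (M * ℓ) 1 2).dualMap z ∈ periodHomology M :=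
    fun z hz ↦ dualMap_degeneracyMap0_mem_periodHomology M (M * ℓ) 1 h1 hz
  have hmemβ : ∀ z ∈ periodHomology (M * ℓ), (degeneracyMap0 M (M * ℓ) ℓ 2).dualMap z ∈ periodHomology M :=
    fun z hz ↦ dualMap_degeneracyMap0_mem_periodHomology M (M * ℓ) ℓ hℓd hz
  -- the closing operator at level `Mℓ` lands in `H₁`
  have hcl : ∀ r, HeckeRing0.T (M * ℓ) 2 q₀ hq₀ • σ₁ r - ((q₀ + 1 : ℕ) : ℂ) • σ₁ r ∈
      periodHomology (M * ℓ) :=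
    T_smul_sub_smul_symbol_mem_periodHomology (M * ℓ) σ₁ hσ₁ hq₀ hq₀1
  -- `Λ''` kills the closed symbols
  have hkill : ∀ r, Λ'' (HeckeRing0.T (M * ℓ) 2 q₀ hq₀ • σ₁ r - ((q₀ + 1 : ℕ) : ℂ) • σ₁ r) = 0 := by
    intro r
    obtain ⟨u, hu⟩ := hc
    have h := pathFun_sub_smul_comp_eq Λ σ₀ hσ₀ σ₁ hσ₁ hq₀ hq₀S c w μ hμ r
    rw [hvan r] at h
    -- `0 = c * Λ''(…)` with `c` a unit
    have : c * Λ'' (HeckeRing0.T (M * ℓ) 2 q₀ hq₀ • σ₁ r - ((q₀ + 1 : ℕ) : ℂ) • σ₁ r) = 0 := by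
      rw [hΛ'']; exact h.symm
    rw [← hu] at this
    simpa using congrArg (fun x ↦ (↑u⁻¹ : k) * x) this
  -- hence `Λ''` kills `(T_{q₀} − q₀ − 1)•x` for every cycle `x` of level `Mℓ`
  have hkillH : ∀ x ∈ periodHomology (M * ℓ),
      Λ'' (HeckeRing0.T (M * ℓ) 2 q₀ hq₀ • x - ((q₀ + 1 : ℕ) : ℂ) • x) = 0 := by
    intro x hx
    rcases exists_eq_zero_or_eq_symbol_of_mem_periodHomology σ₁ hσ₁ hx with rfl | ⟨r, rfl⟩
    · simp only [smul_zero, sub_zero]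
      rw [hΛ'']
      simp only [map_zero]
      rw [apply_zero_of_additiveOn Λ hadd]
      ring
    · exact hkill r
  -- Ihara at `𝔫`
  obtain ⟨s, hs𝔫, hs⟩ := hI M ℓ hℓM 𝔫 h𝔫 h2 (fun hEis ↦ hq₀E (hEis q₀ hq₀ hq₀S hq₀1))
  -- the element `t = (T_{q₀} − q₀ − 1) s ∉ 𝔫`
  set A : HeckeRing0.primeTo M 2 (M * ℓ) :=
    HeckeRing0.primeTo.T M 2 (M * ℓ) hq₀ hq₀S - ((q₀ : HeckeRing0.primeTo M 2 (M * ℓ)) + 1)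
    with hA
  have ht𝔫 : A * s ∉ 𝔫 := fun h ↦ by
    rcases h𝔫.isPrime.mem_or_mem h with h' | h'
    exacts [hq₀E h', hs𝔫 h']
  refine hsupp (A * s) ht𝔫 fun x hx ↦ ?_
  -- lift `(s x, 0)` to a level-`Mℓ` cycle `z`
  obtain ⟨z, hz, hαz, hβz⟩ := hs x hx 0 (periodHomology M).zero_mem
  rw [smul_zero] at hβz
  have key := hkillH z hz
  rw [hΛ''] at key
  simp only [map_sub, dualMap_degeneracyMap0_T_smul h1 hq₀ hq₀S,
    dualMap_degeneracyMap0_T_smul hℓd hq₀ hq₀S, dualMap_degeneracyMap0_natCast_smul, hαz, hβz,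
    smul_zero, sub_zero] at key
  rw [apply_zero_of_additiveOn Λ hadd, mul_zero, sub_zero] at key
  -- `((A * s : 𝕋̃) : 𝕋_ℤ) • x = T_{q₀} • (s • x) − (q₀+1) • (s • x)`
  have hcoe : ((A * s : HeckeRing0.primeTo M 2 (M * ℓ)) : HeckeRing0 M 2) • x =
      HeckeRing0.T M 2 q₀ hq₀ • ((s : HeckeRing0 M 2) • x) -
        ((q₀ + 1 : ℕ) : ℂ) • ((s : HeckeRing0 M 2) • x) := by
    rw [Subalgebra.coe_mul, mul_smul, hA, Subalgebra.coe_sub, Subalgebra.coe_add, Subalgebra.coe_one,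
      SubringClass.coe_natCast, HeckeRing0.primeTo.coe_T, sub_smul, ← Nat.cast_succ,
      Nat.cast_smul_eq_nsmul, Nat.cast_smul_eq_nsmul]
  rw [hcoe]
  exact key

/-- **THE PATH FUNCTION ITSELF VANISHES**: under the hypotheses of
`apply_eq_zero_of_pathFun_sub_smul_comp_eq_zero_of_ribet1984_iharaLemma`, `μ = 0` — the hypothesis
`hinj₀` of `X4/KuriharaAdditiveCertificateOfExactness.plusSymbolLevelLowersAdditivelyModAt_of_exact` and of
`X4/KuriharaAdditiveCertificateTwistOfExactness.exists_families_of_exact` (any sign `w`) for the set of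
path functions of `𝔫`-supported functionals. [cite: Ribet1984ICM, Thm. 4.1] -/
theorem pathFun_eq_zero_of_sub_smul_comp_eq_zero_of_ribet1984_iharaLemma
    (hI : ribet1984_iharaLemma) (hℓM : ¬ ℓ ∣ M)
    (𝔫 : Ideal (HeckeRing0.primeTo M 2 (M * ℓ))) (h𝔫 : 𝔫.IsMaximal)
    (h2 : (2 : HeckeRing0.primeTo M 2 (M * ℓ)) ∉ 𝔫)
    (Λ : Module.Dual ℂ (CuspForm (Gamma0 M) 2) → k)
    (hadd : ∀ x ∈ periodHomology M, ∀ y ∈ periodHomology M, Λ (x + y) = Λ x + Λ y)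
    (hsupp : ∀ t : HeckeRing0.primeTo M 2 (M * ℓ), t ∉ 𝔫 →
      (∀ x ∈ periodHomology M, Λ ((t : HeckeRing0 M 2) • x) = 0) → ∀ x ∈ periodHomology M, Λ x = 0)
    (σ₀ : ℚ → Module.Dual ℂ (CuspForm (Gamma0 M) 2))
    (hσ₀ : ∀ (r : ℚ) (f : CuspForm (Gamma0 M) 2), σ₀ r f = modularSymbol f r)
    (σ₁ : ℚ → Module.Dual ℂ (CuspForm (Gamma0 (M * ℓ)) 2))
    (hσ₁ : ∀ (r : ℚ) (f : CuspForm (Gamma0 (M * ℓ)) 2), σ₁ r f = modularSymbol f r)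
    {q₀ : ℕ} (hq₀ : q₀.Prime) (hq₀1 : q₀ ≡ 1 [MOD M * ℓ]) (hq₀S : ¬ q₀ ∣ M * ℓ)
    (hq₀E : HeckeRing0.primeTo.T M 2 (M * ℓ) hq₀ hq₀S -
      ((q₀ : HeckeRing0.primeTo M 2 (M * ℓ)) + 1) ∉ 𝔫)
    {c : k} (hc : IsUnit c) (w : k) (μ : ℚ → k)
    (hμ : ∀ r, μ r = c * Λ (HeckeRing0.T M 2 q₀ hq₀ • σ₀ r - ((q₀ + 1 : ℕ) : ℂ) • σ₀ r))
    (hvan : ∀ r, μ r - w * μ (ℓ * r) = 0) :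
    μ = fun _ ↦ 0 := by
  have hzero := apply_eq_zero_of_pathFun_sub_smul_comp_eq_zero_of_ribet1984_iharaLemma hI hℓM 𝔫 h𝔫 h2
    Λ hadd hsupp σ₀ hσ₀ σ₁ hσ₁ hq₀ hq₀1 hq₀S hq₀E hc w μ hμ hvan
  have hq₀M : q₀ ≡ 1 [MOD M] := hq₀1.of_mul_right ℓ
  funext r
  rw [hμ, hzero _ (T_smul_sub_smul_symbol_mem_periodHomology M σ₀ hσ₀ hq₀ hq₀M r), mul_zero]

end InjectiveOfIhara

end Summit.BirchSwinnertonDyer.Rank1Residual.LevelLowering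

end
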